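import Mathlib
import Literature.NumberTheory.Transcendental.KZRulesAssociator
import Summits.KontsevichZagierPeriods.KontsevichZagierPeriods.Theorems.SoloInformedZetaOneTwo
import HarnessLib
import HarnessLib.Audit

/-!
# SoloInformed — weight 3: `mzvClass [2,1] = mzvClass [3]` over the Literature's period ring

Solo programme `solo-KontsevichZagierPeriods-informed`, session s45 (PART XVI). The weight-3 telescope
chain `soloInformed_zeta12_sub_zeta3_mem_relations : [Z₁₂ˢ] − [Z₃ˢ] ∈ KZ.relations`
(`SoloInformedZetaOneTwo`) is restated over the LITERATURE's objects: the simplex representations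
`KZ.mzvRep [2,1]`, `KZ.mzvRep [3]` (Kontsevich's form, domain `KZ.openOrderedSimplex 3`), their classes
`KZ.mzvClass` in `FormalPeriodRing = FormalRep ⧸ relations`, and `multipleZeta` (convention
`n₁ > n₂`, so `multipleZeta [2,1] = Σ_{m>n} 1/(m²n)` is Euler's `ζ(2,1) = ζ(3)`).

Main results: `soloInformed_mzvClass_euler3 : mzvClass [2,1] = mzvClass [3]`,
(its `evalP`-shadow `ζ(2,1) = ζ(3)` is the Literature's `euler_zeta_two_one_holds`).
-/

noncomputable section

open MeasureTheory Set MvPolynomial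
open Literature.ModelTheory.ExponentialFields Literature.NumberTheory.Transcendental
open Literature.NumberTheory.Transcendental.KZ

namespace Summit.KontsevichZagierPeriods.KontsevichZagierPeriods.Theorems

/-- `KZ.openOrderedSimplex 3 = soloInformedTelT` (chain form). -/
theorem soloInformed_openOrderedSimplex3_eq : openOrderedSimplex 3 = soloInformedTelT := by
  ext t
  simp only [openOrderedSimplex, soloInformedTelT, soloInformedOpenCube, mem_setOf_eq, mem_inter_iff]
  constructor
  · rintro ⟨h0, h1, hs⟩
    exact ⟨fun j => ⟨h0 j, h1 j⟩, hs (by decide : (0 : Fin 3) < 1), hs (by decide : (1 : Fin 3) < 2)⟩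
  · rintro ⟨hc, h10, h21⟩
    refine ⟨fun j => (hc j).1, fun j => (hc j).2, Fin.strictAnti_iff_succ_lt.2 fun i => ?_⟩
    fin_cases i
    · simpa using h10
    · simpa using h21


/-- `KZ.mzvRep [2,1]` as a representation of dimension `3`. -/
def soloInformedMzv21 : IntegralRep 3 :=
  mzvRep [2, 1] (by decide : MZV.IsAdmissible [2, 1]) (mzvIntegrand_isSemialgebraicFunOn_holds _)
    (mzvIntegrand_integrableOn_holds _ (by decide : MZV.IsAdmissible [2, 1]))
/-- `KZ.mzvRep [3]` as a representation of dimension `3`. -/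
def soloInformedMzv3 : IntegralRep 3 :=
  mzvRep [3] (by decide : MZV.IsAdmissible [3]) (mzvIntegrand_isSemialgebraicFunOn_holds _)
    (mzvIntegrand_integrableOn_holds _ (by decide : MZV.IsAdmissible [3]))

/-- The integrand of `mzvRep [2,1]`. -/
theorem soloInformedM21_integrand (t : Fin 3 → ℝ) :
    soloInformedMzv21.integrand t = 1 / t 0 * (1 / (1 - t 1)) * (1 / (1 - t 2)) := by
  show ∏ i : Fin 3, mzvForm ((MZV.binaryWord [2, 1]).getD i false) (t i) = _
  rw [Fin.prod_univ_three, show MZV.binaryWord [2, 1] = [false, true, true] from rfl]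
  simp [mzvForm]

/-- The integrand of `mzvRep [3]`. -/
theorem soloInformedM3_integrand (t : Fin 3 → ℝ) :
    soloInformedMzv3.integrand t = 1 / t 0 * (1 / t 1) * (1 / (1 - t 2)) := by
  show ∏ i : Fin 3, mzvForm ((MZV.binaryWord [3]).getD i false) (t i) = _
  rw [Fin.prod_univ_three, show MZV.binaryWord [3] = [false, false, true] from rfl]
  simp [mzvForm]

/-- `[Z₁₂ˢ] − [mzvRep [2,1]] ∈ relations` (same representation). -/
theorem soloInformed_z12s_sub_M21 : of soloInformedZ12sRep - of soloInformedMzv21 ∈ relations :=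
  of_sub_of_mem_relations_of_eqOn
    (show soloInformedMzv21.domain = soloInformedZ12sRep.domain from soloInformed_openOrderedSimplex3_eq)
    fun t _ => by
      show soloInformedZ12s t = soloInformedMzv21.integrand t
      rw [soloInformedM21_integrand, soloInformedZ12s, one_div_mul_one_div, one_div_mul_one_div]

/-- `[Z₃ˢ] − [mzvRep [3]] ∈ relations` (same representation). -/
theorem soloInformed_z3s_sub_M3 : of soloInformedZ3sRep - of soloInformedMzv3 ∈ relations :=
  of_sub_of_mem_relations_of_eqOn
    (show soloInformedMzv3.domain = soloInformedZ3sRep.domain from soloInformed_openOrderedSimplex3_eq)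
    fun t _ => by
      show soloInformedZ3s t = soloInformedMzv3.integrand t
      rw [soloInformedM3_integrand, soloInformedZ3s, one_div_mul_one_div, one_div_mul_one_div]

/-- **`[mzvRep [2,1]] − [mzvRep [3]] ∈ KZ.relations`.** -/
theorem soloInformed_M21_sub_M3_mem_relations : of soloInformedMzv21 - of soloInformedMzv3 ∈ relations := by
  have h : of soloInformedMzv21 - of soloInformedMzv3 = (of soloInformedZ12sRep - of soloInformedZ3sRep)
      - (of soloInformedZ12sRep - of soloInformedMzv21) + (of soloInformedZ3sRep - of soloInformedMzv3) := by
    abel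
  rw [h]
  exact relations.add_mem (relations.sub_mem soloInformed_zeta12_sub_zeta3_mem_relations
    soloInformed_z12s_sub_M21) soloInformed_z3s_sub_M3

/-- **COROLLARY (Euler's relation in the formal period ring).** `mzvClass [2,1] = mzvClass [3]`. -/
theorem soloInformed_mzvClass_euler3 : mzvClass [2, 1] = mzvClass [3] := by
  rw [mzvClass_of_isAdmissible (by decide : MZV.IsAdmissible [2, 1]), mzvClass_of_isAdmissible (by decide : MZV.IsAdmissible [3]),
    toFormalPeriod_eq_iff]
  exact soloInformed_M21_sub_M3_mem_relations

/-! *Remark.* Applying `KZ.evalP` (`evalP_mzvClass`) gives back the numerical identity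
`multipleZeta [2,1] = multipleZeta [3]`, which the Literature proves by series manipulations
(`euler_zeta_two_one_holds`); the content of the present file is the lift of the identity to the
formal period ring, i.e. that it follows from Kontsevich–Zagier's rules applied to the integral
representations. -/

end Summit.KontsevichZagierPeriods.KontsevichZagierPeriods.Theorems
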